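import Summits.NavierStokesRegularity.NavierStokesRegularity.Theses.AngularGalerkinLadder
import Summits.NavierStokesRegularity.NavierStokesRegularity.Theorems.NoOverheating.Negative.AsymptoticSymmetryWindowsExcluded
import Literature.Analysis.FluidPDE.RapidDecayLemmas
import HarnessLib

/-!
# KJ-64 — TIME-PERIODIC rung profiles are trivial (route `AngularGalerkinLadder`, cruxes K1
# `RungBlowupCofinal` / K2 `NoOverheating`; refuter lineage, Negative lane)

Stratum (S24), PROFILE-level (a single rung, any Type-I constant `C₀`, any rotation `R`, any
factor `c > 1`): a rung profile that is time-periodic on the past with some period `τ > 0`,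
`u(t − τ, x) = u(t, x)` (`t < 0`), vanishes identically on the past.  Kinematics: rotated discrete
self-similarity `c R⁻¹ u(c² t, c R x) = u(t, x)` transports the period `τ` to `τ / c²`, hence to
`τ / c^{2k}` for every `k`; the non-negative multiples of these periods are dense in `[0, ∞)`, so
by the continuity in time of a classical solution the profile is STEADY on the past, and a steady
field with Type-I decay `C₀/(‖x‖ + √(−t))` is zero (KJ-58
`AsymptoticSymmetryExcluded.eq_zero_of_steady_of_hasTypeIDecay`: let `t → −∞` at fixed `x`).
(S11b) (`RungProfileKinematicRigidity.not_nontrivial_rungProfile_of_steady`) is the case of all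
periods; (S20) is the sequence-level asymptotic-steadiness row.

* `periodic_div_sq_of_isRotatedDSS`, `periodic_div_pow_of_isRotatedDSS`,
  `periodic_mul_div_pow_of_isRotatedDSS` — kinematics of periods under RDSS;
* `tendsto_natFloor_mul` — densification of the multiples of vanishing periods;
* `steady_of_timePeriodic_of_isRotatedDSS` — time-periodic + RDSS + continuous in time ⇒ steady;
* `rungProfile_eq_zero_of_timePeriodic`, `not_nontrivial_rungProfile_of_timePeriodic` (K1's
  witnesses), `no_windowProfile_timePeriodic` (K2's windows).

READING FOR THE CIRCUIT: the time dependence of a supply profile is never periodic — in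
similarity variables `(log(−t), x/√(−t))` the profile is `2 log c`-periodic by construction, but in
PHYSICAL time no period survives.  No `kit`.
[cite: ChaeWolf2017, §3 Step 1 (steady/self-similar exclusion pattern)]
[cite: KochNadirashviliSereginSverak2009, §6 (Type-I ancient solutions)] -/

namespace Summit.NavierStokesRegularity.AngularGalerkinLadderTimePeriodicProfilesExcluded

open Set Filter MeasureTheory Topology Function
open Literature.Analysis Literature.Analysis.FluidPDE
open Summit.NavierStokesRegularity.FluidComputer
open Summit.NavierStokesRegularity.FluidComputer.AngularLadder
open Summit.NavierStokesRegularity.NavierStokesRegularity.Theses.AngularGalerkinLadder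
open Summit.NavierStokesRegularity.AngularGalerkinLadderAsymptoticSymmetryExcluded

/-! ## §1 Kinematics: RDSS divides time periods by `c²` -/

variable {c : ℝ} {R : EuclideanSpace ℝ (Fin 3) ≃ₗᵢ[ℝ] EuclideanSpace ℝ (Fin 3)}
  {u : ℝ → EuclideanSpace ℝ (Fin 3) → EuclideanSpace ℝ (Fin 3)}

/-- A `(c, R)`-RDSS field (`c ≠ 0`) that is `τ`-periodic in time on the past is `τ/c²`-periodic
there. [folklore] -/
theorem periodic_div_sq_of_isRotatedDSS (hc : c ≠ 0) (hdss : IsRotatedDSS c R u) {τ : ℝ}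
    (hper : ∀ t < 0, ∀ x, u (t - τ) x = u t x) : ∀ t < 0, ∀ x, u (t - τ / c ^ 2) x = u t x := by
  intro t ht x
  have hc2 : (0 : ℝ) < c ^ 2 := by positivity
  have hct : c ^ 2 * t < 0 := mul_neg_of_pos_of_neg hc2 ht
  have h1 := hdss (t - τ / c ^ 2) x
  have h2 := hdss t x
  have h3 : c ^ 2 * (t - τ / c ^ 2) = c ^ 2 * t - τ := by
    field_simp
  rw [h3, hper _ hct] at h1
  rw [← h1, ← h2]

/-- Iterating: a `(c, R)`-RDSS field that is `τ`-periodic in time on the past is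
`τ/c^{2k}`-periodic there for every `k`. [folklore] -/
theorem periodic_div_pow_of_isRotatedDSS (hc : c ≠ 0) (hdss : IsRotatedDSS c R u) {τ : ℝ}
    (hper : ∀ t < 0, ∀ x, u (t - τ) x = u t x) (k : ℕ) :
    ∀ t < 0, ∀ x, u (t - τ / c ^ (2 * k)) x = u t x := by
  induction k with
  | zero => simpa using hper
  | succ k ih =>
    have h := periodic_div_sq_of_isRotatedDSS hc hdss ih
    have hk : τ / c ^ (2 * k) / c ^ 2 = τ / c ^ (2 * (k + 1)) := by
      rw [div_div, ← pow_add, show 2 * k + 2 = 2 * (k + 1) by ring]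
    simpa [hk] using h

/-- Non-negative multiples of the transported periods are periods (for `τ ≥ 0`, `0 < c`, the
shifted times stay in the past). [folklore] -/
theorem periodic_mul_div_pow_of_isRotatedDSS (hc : 0 < c) (hdss : IsRotatedDSS c R u) {τ : ℝ}
    (hτ : 0 ≤ τ) (hper : ∀ t < 0, ∀ x, u (t - τ) x = u t x) (m k : ℕ) :
    ∀ t < 0, ∀ x, u (t - m * (τ / c ^ (2 * k))) x = u t x := by
  have hθ : 0 ≤ τ / c ^ (2 * k) := by positivity
  induction m with
  | zero => intro t _ x; simp
  | succ m ih =>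
    intro t ht x
    have hper' := periodic_div_pow_of_isRotatedDSS hc.ne' hdss hper k
    have htm : t - m * (τ / c ^ (2 * k)) < 0 := by nlinarith [(m : ℕ).cast_nonneg (α := ℝ)]
    have h1 := hper' _ htm x
    rw [ih t ht x] at h1
    have h2 : t - m * (τ / c ^ (2 * k)) - τ / c ^ (2 * k) =
        t - ((m + 1 : ℕ) : ℝ) * (τ / c ^ (2 * k)) := by
      push_cast; ring
    rwa [h2] at h1

/-! ## §2 Densification: vanishing periods make a time-continuous field steady -/

/-- For `q ≥ 0` and positive `αₙ → 0`, the multiples `⌊q / αₙ⌋₊ αₙ → q`. [folklore] -/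
theorem tendsto_natFloor_mul {α : ℕ → ℝ} (hα : Tendsto α atTop (𝓝 0)) (hα0 : ∀ n, 0 < α n)
    {q : ℝ} (hq : 0 ≤ q) : Tendsto (fun n => (⌊q / α n⌋₊ : ℝ) * α n) atTop (𝓝 q) := by
  have hlo : Tendsto (fun n => q - α n) atTop (𝓝 q) := by simpa using tendsto_const_nhds.sub hα
  refine tendsto_of_tendsto_of_tendsto_of_le_of_le hlo tendsto_const_nhds (fun n => ?_)
    (fun n => ?_)
  · have h1 : q / α n < (⌊q / α n⌋₊ : ℝ) + 1 := Nat.lt_floor_add_one _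
    have h2 := (div_lt_iff₀ (hα0 n)).1 h1
    show q - α n ≤ (⌊q / α n⌋₊ : ℝ) * α n
    nlinarith
  · have h1 : (⌊q / α n⌋₊ : ℝ) ≤ q / α n := Nat.floor_le (div_nonneg hq (hα0 n).le)
    show (⌊q / α n⌋₊ : ℝ) * α n ≤ q
    exact (le_div_iff₀ (hα0 n)).1 h1

/-- **Time-periodic + RDSS + continuous in time ⇒ steady on the past.**  A `(c, R)`-RDSS field,
`1 < c`, continuous in time on `(−∞, 0)` at every point and `τ`-periodic in time on the past for
some `τ > 0`, is steady on the past. [folklore] -/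
theorem steady_of_timePeriodic_of_isRotatedDSS (hc : 1 < c) (hdss : IsRotatedDSS c R u)
    (hcont : ∀ x, ContinuousOn (fun s => u s x) (Iio 0)) {τ : ℝ} (hτ : 0 < τ)
    (hper : ∀ t < 0, ∀ x, u (t - τ) x = u t x) : ∀ s < 0, ∀ t < 0, ∀ x, u s x = u t x := by
  have hc0 : 0 < c := zero_lt_one.trans hc
  -- it suffices to treat `s < t`
  suffices key : ∀ s < 0, ∀ t < 0, s < t → ∀ x, u s x = u t x by
    intro s hs t ht x
    rcases lt_trichotomy s t with h | rfl | h
    · exact key s hs t ht h x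
    · rfl
    · exact (key t ht s hs h x).symm
  intro s hs t ht hst x
  -- the periods `αₖ = τ / c^{2k} → 0`
  set α : ℕ → ℝ := fun k => τ / c ^ (2 * k) with hα_def
  have hα0 : ∀ k, 0 < α k := fun k => by rw [hα_def]; positivity
  have hα : Tendsto α atTop (𝓝 0) := by
    have h1 : Tendsto (fun k : ℕ => (c ^ 2)⁻¹ ^ k) atTop (𝓝 0) := by
      refine tendsto_pow_atTop_nhds_zero_of_lt_one (by positivity) ?_
      exact inv_lt_one_of_one_lt₀ (by nlinarith)
    have h2 := h1.const_mul τ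
    rw [mul_zero] at h2
    refine h2.congr fun k => ?_
    rw [hα_def]
    simp only
    rw [pow_mul, div_eq_mul_inv, inv_pow]
  -- the times `rₖ = t − ⌊(t − s)/αₖ⌋₊ αₖ → s` from the right, with `u(rₖ, x) = u(t, x)`
  have hq : 0 ≤ t - s := by linarith
  have hr : Tendsto (fun k => t - (⌊(t - s) / α k⌋₊ : ℝ) * α k) atTop (𝓝 s) := by
    have h := (tendsto_const_nhds : Tendsto (fun _ : ℕ => t) atTop (𝓝 t)).sub
      (tendsto_natFloor_mul hα hα0 hq)
    simpa using h
  have hrneg : ∀ k, t - (⌊(t - s) / α k⌋₊ : ℝ) * α k < 0 := fun k => by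
    have : 0 ≤ (⌊(t - s) / α k⌋₊ : ℝ) * α k := by positivity
    linarith
  have hur : ∀ k, u (t - (⌊(t - s) / α k⌋₊ : ℝ) * α k) x = u t x := fun k =>
    periodic_mul_div_pow_of_isRotatedDSS hc0 hdss hτ.le hper _ k t ht x
  -- continuity in time at `s` within the past
  have hsx : ContinuousWithinAt (fun r => u r x) (Iio 0) s := hcont x s hs
  have hlim : Tendsto (fun k => u (t - (⌊(t - s) / α k⌋₊ : ℝ) * α k) x) atTop (𝓝 (u s x)) :=
    hsx.tendsto.comp (tendsto_nhdsWithin_iff.2 ⟨hr, Eventually.of_forall hrneg⟩)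
  have hconst : Tendsto (fun k => u (t - (⌊(t - s) / α k⌋₊ : ℝ) * α k) x) atTop
      (𝓝 (u t x)) := by
    simp only [hur]
    exact tendsto_const_nhds
  exact tendsto_nhds_unique hlim hconst

/-! ## §3 (S24): time-periodic rung profiles are trivial; no time-periodic window profile -/

variable {L : ℕ} {C₀ : ℝ} {p : ℝ → EuclideanSpace ℝ (Fin 3) → ℝ}
  {d : ℝ → EuclideanSpace ℝ (Fin 3) → EuclideanSpace ℝ (Fin 3)}

/-- **(S24) A time-periodic rung profile vanishes on the past** (any `C₀`, any rotation, any
factor): RDSS transports the period `τ` to `τ/c^{2k} → 0`, continuity in time (classical solution)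
makes the profile steady, and a steady field with Type-I decay is zero
(`eq_zero_of_steady_of_hasTypeIDecay`). [cite: KochNadirashviliSereginSverak2009, §6 (Type-I ancient solutions)] -/
theorem rungProfile_eq_zero_of_timePeriodic (hP : IsRungProfile L C₀ c R u p d) {τ : ℝ}
    (hτ : 0 < τ) (hper : ∀ t < 0, ∀ x, u (t - τ) x = u t x) : ∀ t < 0, ∀ x, u t x = 0 :=
  eq_zero_of_steady_of_hasTypeIDecay hP.hasTypeIDecay
    (steady_of_timePeriodic_of_isRotatedDSS hP.one_lt hP.isRotatedDSS
      (fun x => hP.classical.smooth_velocity.continuousOn_time x) hτ hper)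

/-- **(S24) for K1's witnesses**: a time-periodic rung profile is not a `RungIsSingular`
witness. -/
theorem not_nontrivial_rungProfile_of_timePeriodic (hP : IsRungProfile L C₀ c R u p d) {τ : ℝ}
    (hτ : 0 < τ) (hper : ∀ t < 0, ∀ x, u (t - τ) x = u t x) : ¬ ∃ t < 0, ∃ x, u t x ≠ 0 :=
  fun ⟨t, ht, x, hx⟩ => hx (rungProfile_eq_zero_of_timePeriodic hP hτ hper t ht x)

/-- **(S24) for K2's windows**: no window profile (`0 < δ`) is time-periodic on the past — ANY
`C₀`, ANY window, ANY rotation. -/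
theorem no_windowProfile_timePeriodic {cmin cmax δ ε : ℝ} (hδ : 0 < δ)
    (hW : IsWindowProfile L C₀ cmin cmax δ ε c R u p d) {τ : ℝ} (hτ : 0 < τ)
    (hper : ∀ t < 0, ∀ x, u (t - τ) x = u t x) : False := by
  obtain ⟨hP, -, -, ⟨x₀, hx₀⟩, -⟩ := hW
  have h0 := rungProfile_eq_zero_of_timePeriodic hP hτ hper (-1) (by norm_num) x₀
  rw [h0, norm_zero] at hx₀
  exact absurd hx₀ (not_le.2 hδ)

/-- **(S24) against the cruxes**: `RungIsSingular L` is never witnessed by a time-periodic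
profile, at any rung. -/
theorem rungIsSingular_witness_not_timePeriodic
    (h : ∃ (C₀ c : ℝ) (R : EuclideanSpace ℝ (Fin 3) ≃ₗᵢ[ℝ] EuclideanSpace ℝ (Fin 3))
      (u : ℝ → EuclideanSpace ℝ (Fin 3) → EuclideanSpace ℝ (Fin 3))
      (p : ℝ → EuclideanSpace ℝ (Fin 3) → ℝ)
      (d : ℝ → EuclideanSpace ℝ (Fin 3) → EuclideanSpace ℝ (Fin 3)) (τ : ℝ),
      IsRungProfile L C₀ c R u p d ∧ 0 < τ ∧ (∀ t < 0, ∀ x, u (t - τ) x = u t x) ∧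
        ∃ t < 0, ∃ x, u t x ≠ 0) : False := by
  obtain ⟨C₀, c, R, u, p, d, τ, hP, hτ, hper, hnz⟩ := h
  exact not_nontrivial_rungProfile_of_timePeriodic hP hτ hper hnz

end Summit.NavierStokesRegularity.AngularGalerkinLadderTimePeriodicProfilesExcluded
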